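import Summits.CriticalPhenomena.CardyFormulaZ2.Theorems.CardyBoundaryCoulombGasHalfPlaneMarkDensityLawLatticeMoves

/-!
# Line `Sketch`, open stub C⁺ — a priori structure of the collinear half-plane crossing function, II:
# equicontinuity of `P_n` in the four marks and asymptotic translation invariance
# (crux stmt-CriticalPhenomena-5661, lead c2-0)

`P_n(a,b,c,y) := P_{1/2}[[⌊an⌋,⌊bn⌋]×{0} ↔ [⌊cn⌋,⌊yn⌋]×{0} in ℤ×ℕ]` (the sequence of stub C⁺).
* §3 monotonicity of `P_n` in each mark; the **`δ`-move bound** `eventually_move_le` (both arcs grow,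
  every mark moves `≤ δ`, `10δ ≤` new gap ⟹ eventually `P_n(new) ≤ P_n(old) + 4C(8δ/gap)^α`):
  equicontinuity on compacts of the chamber; the small-source-arc bound `le_of_small_source`.
* §4 exact lattice translation `crossing_shift`; **asymptotic translation invariance**
  `tendsto_translate_sub`: `P_n(a+t,b+t,c+t,y+t) − P_n(a,b,c,y) → 0`.
Registered extra stubs of the line: `stub_equicontinuity`, `stub_translationInvariance`.
-/

noncomputable section

namespace Summit.CriticalPhenomena.CardyFormulaZ2.Cruxes.HalfPlaneMarkDensityLaw.SketchLine

open Literature.Probability.Percolation Literature.Probability.LatticeModels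
open MeasureTheory Filter Set
open scoped Topology
open Summit.CriticalPhenomena.CardyFormulaZ2.Theorems.HalfPlaneMarkDensityLaw.Negative

namespace Subseq

/-! ## §3 Continuum corollaries for `P_n(a,b,c,y) = Q(⌊an⌋,⌊bn⌋,⌊cn⌋,⌊yn⌋)` -/

/-- The crux's arc `A_n` is the boundary segment `[⌊an⌋,⌊bn⌋]×{0}`. [folklore] -/
theorem arcA_eq_rowIcc (a b : ℝ) (n : ℕ) : arcA a b n = rowIcc ⌊a * n⌋ ⌊b * n⌋ := rfl

/-- Floors of scaled marks are monotone. [folklore] -/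
theorem floor_mul_le_floor_mul {x x' : ℝ} (h : x ≤ x') (n : ℕ) : ⌊x * n⌋ ≤ ⌊x' * n⌋ :=
  Int.floor_le_floor (mul_le_mul_of_nonneg_right h (Nat.cast_nonneg n))

/-- `P_n` is nondecreasing in the fourth mark `y`. [folklore] -/
theorem P_mono_y (a b c : ℝ) {y y' : ℝ} (h : y ≤ y') (n : ℕ) :
    μ.real (openCrossing halfPlane (arcA a b n) (rowIcc ⌊c * n⌋ ⌊y * n⌋)) ≤
      μ.real (openCrossing halfPlane (arcA a b n) (rowIcc ⌊c * n⌋ ⌊y' * n⌋)) :=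
  crossing_mono_l _ _ _ (floor_mul_le_floor_mul h n)

/-- `P_n` is nonincreasing in the third mark `c`. [folklore] -/
theorem P_anti_c (a b y : ℝ) {c c' : ℝ} (h : c' ≤ c) (n : ℕ) :
    μ.real (openCrossing halfPlane (arcA a b n) (rowIcc ⌊c * n⌋ ⌊y * n⌋)) ≤
      μ.real (openCrossing halfPlane (arcA a b n) (rowIcc ⌊c' * n⌋ ⌊y * n⌋)) :=
  crossing_mono_k _ _ _ (floor_mul_le_floor_mul h n)

/-- `P_n` is nondecreasing in the second mark `b`. [folklore] -/
theorem P_mono_b (a c y : ℝ) {b b' : ℝ} (h : b ≤ b') (n : ℕ) :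
    μ.real (openCrossing halfPlane (arcA a b n) (rowIcc ⌊c * n⌋ ⌊y * n⌋)) ≤
      μ.real (openCrossing halfPlane (arcA a b' n) (rowIcc ⌊c * n⌋ ⌊y * n⌋)) :=
  crossing_mono_j _ _ _ (floor_mul_le_floor_mul h n)

/-- `P_n` is nonincreasing in the first mark `a`. [folklore] -/
theorem P_anti_a (b c y : ℝ) {a a' : ℝ} (h : a' ≤ a) (n : ℕ) :
    μ.real (openCrossing halfPlane (arcA a b n) (rowIcc ⌊c * n⌋ ⌊y * n⌋)) ≤
      μ.real (openCrossing halfPlane (arcA a' b n) (rowIcc ⌊c * n⌋ ⌊y * n⌋)) :=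
  crossing_mono_i _ _ _ (floor_mul_le_floor_mul h n)

/-- **Joint monotonicity of `P_n`**: growing both arcs increases the crossing probability. [folklore] -/
theorem P_mono {a a' b b' c c' y y' : ℝ} (ha : a' ≤ a) (hb : b ≤ b') (hc : c' ≤ c) (hy : y ≤ y')
    (n : ℕ) :
    μ.real (openCrossing halfPlane (arcA a b n) (rowIcc ⌊c * n⌋ ⌊y * n⌋)) ≤
      μ.real (openCrossing halfPlane (arcA a' b' n) (rowIcc ⌊c' * n⌋ ⌊y' * n⌋)) :=
  (P_anti_a b c y ha n).trans <| (P_mono_b a' c y hb n).trans <|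
    (P_anti_c a' b' y hc n).trans (P_mono_y a' b' c' hy n)

/-- Moving a mark by `≤ δ` moves its lattice site by `≤ ⌈δn⌉ + 1`. [folklore] -/
theorem floor_sub_floor_le {x x' δ : ℝ} (h : x - x' ≤ δ) (n : ℕ) :
    ⌊x * n⌋ - ⌊x' * n⌋ ≤ ((⌈δ * n⌉₊ + 1 : ℕ) : ℤ) := by
  have h1 : (⌊x * n⌋ : ℝ) ≤ x * n := Int.floor_le _
  have h2 : x' * n < ⌊x' * n⌋ + 1 := Int.lt_floor_add_one _
  have h3 : δ * n ≤ ⌈δ * n⌉₊ := Nat.le_ceil _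
  have h4 : (x - x') * n ≤ δ * n := mul_le_mul_of_nonneg_right h (Nat.cast_nonneg n)
  have h5 : ((⌊x * n⌋ - ⌊x' * n⌋ : ℤ) : ℝ) < ((⌈δ * n⌉₊ + 1 : ℕ) : ℤ) := by
    push_cast; nlinarith
  exact (Int.cast_lt.1 h5).le

section Moves

variable {C α : ℝ} (hC : 0 ≤ C) (hα : 0 < α)
  (hesc : ∀ p : unitInterval, (p : ℝ) ≤ 1 / 2 → ∀ r R : ℕ, 1 ≤ r → r ≤ R →
    (bondPercolation (zdGraph 2) p).real
      {ω | ∃ x ∈ box 2 r, ∃ y ∉ box 2 R, ω ∈ openConnIn Set.univ x y} ≤ C * ((r : ℝ) / R) ^ α)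
include hC hα hesc

/-- **The `δ`-move bound.** If the arcs `[a,b]`, `[c,y]` grow to `[a',b']`, `[c',y']` with every mark
moving by `≤ δ` and `10 δ ≤ c' − b'`, then eventually in `n`,
`P_n(a',b',c',y') ≤ P_n(a,b,c,y) + 4C(8δ/(c'−b'))^α`. [folklore] -/
theorem eventually_move_le {a a' b b' c c' y y' δ : ℝ} (ha : a' ≤ a) (hb : b ≤ b') (hc : c' ≤ c)
    (hy : y ≤ y') (hab : a ≤ b) (hcy : c ≤ y) (hδ : 0 < δ) (hda : a - a' ≤ δ) (hdb : b' - b ≤ δ)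
    (hdc : c - c' ≤ δ) (hdy : y' - y ≤ δ) (hgap : 10 * δ ≤ c' - b') :
    ∀ᶠ n : ℕ in atTop,
      μ.real (openCrossing halfPlane (arcA a' b' n) (rowIcc ⌊c' * n⌋ ⌊y' * n⌋)) ≤
        μ.real (openCrossing halfPlane (arcA a b n) (rowIcc ⌊c * n⌋ ⌊y * n⌋)) +
          4 * (C * (8 * δ / (c' - b')) ^ α) := by
  set g := c' - b' with hg
  have hg0 : 0 < g := by linarith
  have e1 : ∀ᶠ n : ℕ in atTop, 1 ≤ δ * n :=
    (tendsto_natCast_atTop_atTop.const_mul_atTop hδ).eventually_ge_atTop 1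
  have e2 : ∀ᶠ n : ℕ in atTop, 8 ≤ g * n :=
    (tendsto_natCast_atTop_atTop.const_mul_atTop hg0).eventually_ge_atTop 8
  filter_upwards [e1, e2] with n hn1 hn2
  -- the lattice data
  set m : ℕ := ⌈δ * n⌉₊ + 1 with hm
  set R : ℕ := ⌊g * n / 2⌋₊ with hR
  have hm_le : (m : ℝ) ≤ 3 * (δ * n) := by
    have := Nat.ceil_lt_add_one (show 0 ≤ δ * n by positivity)
    rw [hm]; push_cast; linarith
  have hR_le : (R : ℝ) ≤ g * n / 2 := Nat.floor_le (by positivity)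
  have hR_ge : g * n / 2 - 1 < R := by rw [hR]; exact Nat.sub_one_lt_floor _
  have hR_ge' : 3 * (g * n) / 8 ≤ R := by linarith
  have hRpos : (0 : ℝ) < R := by linarith
  have hm1 : 1 ≤ m := by rw [hm]; omega
  have hmR_real : (m : ℝ) ≤ R := by nlinarith
  have hmR : m ≤ R := by exact_mod_cast hmR_real
  -- the gap in lattice units
  have hRgap : (R : ℤ) ≤ ⌊c' * n⌋ - ⌊b' * n⌋ - 2 := by
    have h1 : (c' * n : ℝ) < ⌊c' * n⌋ + 1 := Int.lt_floor_add_one _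
    have h2 : (⌊b' * n⌋ : ℝ) ≤ b' * n := Int.floor_le _
    have h3 : ((R : ℤ) : ℝ) < ((⌊c' * n⌋ - ⌊b' * n⌋ - 2 : ℤ) : ℝ) := by
      push_cast
      have : (R : ℝ) ≤ g * n - 3 := by linarith
      rw [hg] at this
      linarith
    exact (Int.cast_lt.1 h3).le
  have key := (move_le hesc (floor_mul_le_floor_mul ha n) (floor_mul_le_floor_mul hb n)
    (floor_mul_le_floor_mul hc n) (floor_mul_le_floor_mul hy n) (floor_mul_le_floor_mul hab n)
    (floor_mul_le_floor_mul hcy n) hm1 hmR (floor_sub_floor_le hda n) (floor_sub_floor_le hdb n)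
    (floor_sub_floor_le hdc n) (floor_sub_floor_le hdy n) hRgap).2
  -- compare the error terms
  have hratio : (m : ℝ) / R ≤ 8 * δ / g := by
    rw [div_le_div_iff₀ hRpos hg0]
    nlinarith
  have hpow : ((m : ℝ) / R) ^ α ≤ (8 * δ / g) ^ α :=
    Real.rpow_le_rpow (by positivity) hratio hα.le
  have : C * ((m : ℝ) / R) ^ α ≤ C * (8 * δ / g) ^ α := mul_le_mul_of_nonneg_left hpow hC
  rw [arcA_eq_rowIcc, arcA_eq_rowIcc]
  linarith

omit hC hα in
/-- **Small source arc, lattice form**: once `(c − b) n ≥ 5`,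
`P_n(a,b,c,y) ≤ C ((⌈(b−a)n⌉ + 1)/(⌊(c−a)n⌋ − 2))^α` (the source arc joined to anything at horizontal
distance `≥` the gap is an escape). [folklore] -/
theorem le_of_small_source {a b c y : ℝ} (hab : a ≤ b) {n : ℕ} (hn : 5 ≤ (c - b) * n) :
    μ.real (openCrossing halfPlane (arcA a b n) (rowIcc ⌊c * n⌋ ⌊y * n⌋)) ≤
      C * (((⌈(b - a) * n⌉₊ + 1 : ℕ) : ℝ) / ((⌊(c - a) * n⌋₊ - 2 : ℕ) : ℝ)) ^ α := by
  have hba : 0 ≤ (b - a) * n := mul_nonneg (by linarith) (Nat.cast_nonneg n)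
  have hcb : (c - b) * n ≤ (c - a) * n := mul_le_mul_of_nonneg_right (by linarith) (Nat.cast_nonneg n)
  have hca0 : (0 : ℝ) ≤ (c - a) * n := by linarith
  have h5 : (5 : ℝ) ≤ ⌊(c - a) * n⌋₊ := by
    have := Nat.floor_le_floor (hn.trans hcb)
    rw [show ⌊(5 : ℝ)⌋₊ = 5 by norm_num] at this
    exact_mod_cast this
  have h5' : 5 ≤ ⌊(c - a) * n⌋₊ := by exact_mod_cast h5
  have hRcast : (((⌊(c - a) * n⌋₊ - 2 : ℕ)) : ℝ) = ⌊(c - a) * n⌋₊ - 2 := by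
    rw [Nat.cast_sub (by omega)]; norm_num
  have hR_ge : (c - a) * n - 3 < (((⌊(c - a) * n⌋₊ - 2 : ℕ)) : ℝ) := by
    rw [hRcast]; have := Nat.sub_one_lt_floor ((c - a) * n); linarith
  have hR_le : (((⌊(c - a) * n⌋₊ - 2 : ℕ)) : ℝ) ≤ (c - a) * n - 2 := by
    rw [hRcast]; have := Nat.floor_le hca0; linarith
  have hr_lt : (((⌈(b - a) * n⌉₊ + 1 : ℕ)) : ℝ) < (b - a) * n + 2 := by
    push_cast; have := Nat.ceil_lt_add_one hba; linarith
  refine measureReal_interval_crossing_le hesc halfPlane (k₁ := ⌊a * n⌋) (k₂ := ⌊b * n⌋)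
    (floor_sub_floor_le le_rfl n) (by omega) ?_ ?_
  · exact_mod_cast (show (((⌈(b - a) * n⌉₊ + 1 : ℕ)) : ℝ) ≤ (((⌊(c - a) * n⌋₊ - 2 : ℕ)) : ℝ) by
      nlinarith)
  · intro v hv
    right
    have h1 : (⌊a * n⌋ : ℝ) ≤ a * n := Int.floor_le _
    have h2 : (c * n : ℝ) < ⌊c * n⌋ + 1 := Int.lt_floor_add_one _
    have h3 : ((⌊a * (n : ℝ)⌋ + ((⌊(c - a) * n⌋₊ - 2 : ℕ) : ℤ) : ℤ) : ℝ) < ((⌊c * (n : ℝ)⌋ : ℤ) : ℝ) := by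
      push_cast [Nat.cast_sub (show 2 ≤ ⌊(c - a) * n⌋₊ by omega)]
      have := Nat.floor_le hca0
      nlinarith
    have h4 := Int.cast_lt.1 h3
    have := hv.2.1
    omega

omit hC hesc in
/-- The lattice bound of `le_of_small_source` tends to `C((b−a)/(c−a))^α`. [folklore] -/
theorem tendsto_small_source_bound {a b c : ℝ} (hab : a ≤ b) (hac : a < c) :
    Tendsto (fun n : ℕ ↦ C * (((⌈(b - a) * n⌉₊ + 1 : ℕ) : ℝ) / ((⌊(c - a) * n⌋₊ - 2 : ℕ) : ℝ)) ^ α)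
      atTop (𝓝 (C * ((b - a) / (c - a)) ^ α)) := by
  have hca : 0 < c - a := by linarith
  -- numerator / n → b - a
  have hnum : Tendsto (fun n : ℕ ↦ (((⌈(b - a) * n⌉₊ + 1 : ℕ)) : ℝ) / n) atTop (𝓝 (b - a)) := by
    have lo : ∀ n : ℕ, 1 ≤ n → b - a ≤ (((⌈(b - a) * n⌉₊ + 1 : ℕ)) : ℝ) / n := by
      intro n hn
      have hn' : (0 : ℝ) < n := by exact_mod_cast hn
      rw [le_div_iff₀ hn']; push_cast
      have := Nat.le_ceil ((b - a) * n); linarith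
    have hi : ∀ n : ℕ, 1 ≤ n → (((⌈(b - a) * n⌉₊ + 1 : ℕ)) : ℝ) / n ≤ b - a + 2 / n := by
      intro n hn
      have hn' : (0 : ℝ) < n := by exact_mod_cast hn
      rw [div_le_iff₀ hn', add_mul, div_mul_cancel₀ _ hn'.ne']; push_cast
      have := Nat.ceil_lt_add_one (mul_nonneg (by linarith : 0 ≤ b - a) hn'.le); linarith
    have hlim : Tendsto (fun n : ℕ ↦ b - a + 2 / (n : ℝ)) atTop (𝓝 (b - a)) := by
      simpa using tendsto_const_nhds.add (tendsto_const_div_atTop_nhds_zero_nat (2 : ℝ))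
    exact tendsto_of_tendsto_of_tendsto_of_le_of_le' tendsto_const_nhds hlim
      (eventually_atTop.2 ⟨1, lo⟩) (eventually_atTop.2 ⟨1, hi⟩)
  -- denominator / n → c - a
  have hden : Tendsto (fun n : ℕ ↦ (((⌊(c - a) * n⌋₊ - 2 : ℕ)) : ℝ) / n) atTop (𝓝 (c - a)) := by
    have e5 : ∀ᶠ n : ℕ in atTop, 5 ≤ (c - a) * n :=
      (tendsto_natCast_atTop_atTop.const_mul_atTop hca).eventually_ge_atTop 5
    have lo : ∀ᶠ n : ℕ in atTop, c - a - 3 / n ≤ (((⌊(c - a) * n⌋₊ - 2 : ℕ)) : ℝ) / n := by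
      filter_upwards [e5, eventually_ge_atTop 1] with n hn hn1
      have hn' : (0 : ℝ) < n := by exact_mod_cast hn1
      have h5 : 5 ≤ ⌊(c - a) * n⌋₊ := by
        have := Nat.floor_le_floor hn
        rw [show ⌊(5 : ℝ)⌋₊ = 5 by norm_num] at this
        exact this
      rw [le_div_iff₀ hn', sub_mul, div_mul_cancel₀ _ hn'.ne', Nat.cast_sub (by omega)]
      push_cast
      have := Nat.sub_one_lt_floor ((c - a) * n); linarith
    have hi : ∀ᶠ n : ℕ in atTop, (((⌊(c - a) * n⌋₊ - 2 : ℕ)) : ℝ) / n ≤ c - a := by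
      filter_upwards [e5, eventually_ge_atTop 1] with n hn hn1
      have hn' : (0 : ℝ) < n := by exact_mod_cast hn1
      have h5 : 5 ≤ ⌊(c - a) * n⌋₊ := by
        have := Nat.floor_le_floor hn
        rw [show ⌊(5 : ℝ)⌋₊ = 5 by norm_num] at this
        exact this
      rw [div_le_iff₀ hn', Nat.cast_sub (by omega)]
      push_cast
      have := Nat.floor_le (show 0 ≤ (c - a) * n by positivity); linarith
    have hlim : Tendsto (fun n : ℕ ↦ c - a - 3 / (n : ℝ)) atTop (𝓝 (c - a)) := by
      simpa using tendsto_const_nhds.sub (tendsto_const_div_atTop_nhds_zero_nat (3 : ℝ))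
    exact tendsto_of_tendsto_of_tendsto_of_le_of_le' hlim tendsto_const_nhds lo hi
  have hratio : Tendsto (fun n : ℕ ↦ (((⌈(b - a) * n⌉₊ + 1 : ℕ)) : ℝ) / ((⌊(c - a) * n⌋₊ - 2 : ℕ) : ℝ))
      atTop (𝓝 ((b - a) / (c - a))) := by
    refine ((hnum.div hden hca.ne').congr' ?_)
    filter_upwards [eventually_ge_atTop 1] with n hn
    have hn' : (n : ℝ) ≠ 0 := by positivity
    simp only [Pi.div_apply]
    rw [div_div_div_cancel_right₀ hn']
  have hpow := hratio.rpow_const (p := α) (Or.inr hα.le)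
  exact hpow.const_mul C

end Moves

/-! ## §4 Exact lattice translation and asymptotic translation invariance of `P_n` -/

/-- Horizontal translates of boundary segments. [folklore] -/
theorem image_add_rowIcc (s i j : ℤ) :
    (· + (![s, 0] : Site 2)) '' rowIcc i j = rowIcc (i + s) (j + s) := by
  rw [BoxExhaustion.image_add_eq]
  ext v
  simp only [rowIcc, mem_setOf_eq, Pi.sub_apply, Matrix.cons_val_one, Matrix.cons_val_zero,
    sub_zero]
  omega

/-- The lattice half-plane is invariant under horizontal translations. [folklore] -/
theorem image_add_halfPlane (s : ℤ) : (· + (![s, 0] : Site 2)) '' halfPlane = halfPlane := by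
  rw [BoxExhaustion.image_add_eq]
  ext v
  simp only [halfPlane, mem_setOf_eq, Pi.sub_apply, Matrix.cons_val_one, Matrix.cons_val_zero,
    sub_zero]

/-- **Exact translation invariance of `Q`** (translation invariance of `P_{1/2}` and of `ℤ×ℕ` under
horizontal shifts). [folklore] -/
theorem crossing_shift (s i j k l : ℤ) :
    μ.real (openCrossing halfPlane (rowIcc (i + s) (j + s)) (rowIcc (k + s) (l + s))) =
      μ.real (openCrossing halfPlane (rowIcc i j) (rowIcc k l)) := by
  rw [← image_add_rowIcc s i j, ← image_add_rowIcc s k l]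
  conv_lhs => rw [← image_add_halfPlane s]
  unfold μ
  exact real_openCrossing_shift half _ _ _ _

/-- `⌊xn⌋ + ⌊tn⌋ ≤ ⌊(x+t)n⌋`. [folklore] -/
theorem floor_add_floor_le_floor_add_mul (x t : ℝ) (n : ℕ) : ⌊x * n⌋ + ⌊t * n⌋ ≤ ⌊(x + t) * n⌋ := by
  rw [add_mul]; exact Int.le_floor_add _ _

/-- `⌊(x+t)n⌋ ≤ ⌊xn⌋ + ⌊tn⌋ + 1`. [folklore] -/
theorem floor_add_mul_le (x t : ℝ) (n : ℕ) : ⌊(x + t) * n⌋ ≤ ⌊x * n⌋ + ⌊t * n⌋ + 1 := by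
  rw [add_mul]; have := Int.le_floor_add_floor (x * n) (t * n); omega

/-- The translation error tends to `0`. [folklore] -/
theorem tendsto_translate_error (C : ℝ) {α : ℝ} (hα : 0 < α) {g : ℝ} (hg : 0 < g) :
    Tendsto (fun n : ℕ ↦ 8 * (C * ((1 : ℝ) / ⌊g * n / 2⌋₊) ^ α)) atTop (𝓝 0) := by
  have h0 : Tendsto (fun n : ℕ ↦ g * n / 2 - 1) atTop atTop := by
    refine tendsto_atTop_add_const_right _ _ (Tendsto.atTop_div_const (by norm_num) ?_)
    exact tendsto_natCast_atTop_atTop.const_mul_atTop hg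
  have h1 : Tendsto (fun n : ℕ ↦ ((⌊g * n / 2⌋₊ : ℕ) : ℝ)) atTop atTop :=
    tendsto_atTop_mono (fun n ↦ (Nat.sub_one_lt_floor _).le) h0
  have h2 : Tendsto (fun n : ℕ ↦ (((⌊g * n / 2⌋₊ : ℕ) : ℝ))⁻¹) atTop (𝓝 0) := h1.inv_tendsto_atTop
  have h3 : Tendsto (fun n : ℕ ↦ ((((⌊g * n / 2⌋₊ : ℕ) : ℝ))⁻¹) ^ α) atTop (𝓝 ((0 : ℝ) ^ α)) :=
    (Real.continuousAt_rpow_const 0 α (Or.inr hα.le)).tendsto.comp h2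
  rw [Real.zero_rpow hα.ne'] at h3
  have h4 := (h3.const_mul C).const_mul 8
  simp only [mul_zero] at h4
  refine h4.congr fun n ↦ ?_
  rw [one_div]

section Moves

variable {C α : ℝ}
  (hesc : ∀ p : unitInterval, (p : ℝ) ≤ 1 / 2 → ∀ r R : ℕ, 1 ≤ r → r ≤ R →
    (bondPercolation (zdGraph 2) p).real
      {ω | ∃ x ∈ box 2 r, ∃ y ∉ box 2 R, ω ∈ openConnIn Set.univ x y} ≤ C * ((r : ℝ) / R) ^ α)
include hesc

/-- **Translation costs `≤ 8C/R^α` at lattice level**: moving all four marks by `t` changes `P_n` by at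
most twice the joint-move error with `m = 1`, `R = ⌊(c−b)n/2⌋`, once `(c − b) n ≥ 8`. [folklore] -/
theorem abs_translate_sub_le {a b c y : ℝ} (hab : a ≤ b) (hbc : b < c) (hcy : c ≤ y) (t : ℝ) {n : ℕ}
    (hn : 8 ≤ (c - b) * n) :
    |μ.real (openCrossing halfPlane (arcA (a + t) (b + t) n) (rowIcc ⌊(c + t) * n⌋ ⌊(y + t) * n⌋)) -
        μ.real (openCrossing halfPlane (arcA a b n) (rowIcc ⌊c * n⌋ ⌊y * n⌋))| ≤
      8 * (C * ((1 : ℝ) / ⌊(c - b) * n / 2⌋₊) ^ α) := by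
  set g := c - b with hg
  have hg0 : 0 < g := by rw [hg]; linarith
  set R : ℕ := ⌊g * n / 2⌋₊ with hR
  set s : ℤ := ⌊t * n⌋ with hs
  have hR_le : (R : ℝ) ≤ g * n / 2 := Nat.floor_le (by positivity)
  have hR_ge : g * n / 2 - 1 < R := by rw [hR]; exact Nat.sub_one_lt_floor _
  have hR1_real : (1 : ℝ) ≤ R := by linarith
  have hR1 : 1 ≤ R := by exact_mod_cast hR1_real
  have hRgap : (R : ℤ) ≤ (⌊c * n⌋ + s) - (⌊b * n⌋ + s + 1) - 2 := by
    have h1 : (c * n : ℝ) < ⌊c * n⌋ + 1 := Int.lt_floor_add_one _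
    have h2 : (⌊b * n⌋ : ℝ) ≤ b * n := Int.floor_le _
    have h3 : ((R : ℤ) : ℝ) < (((⌊c * n⌋ + s) - (⌊b * n⌋ + s + 1) - 2 : ℤ) : ℝ) := by
      push_cast
      have : (R : ℝ) ≤ g * n - 4 := by linarith
      rw [hg] at this
      linarith
    exact (Int.cast_lt.1 h3).le
  -- (A) the upper corner against the shifted configuration
  have hA := move_le hesc (i := ⌊a * n⌋ + s) (i' := ⌊a * n⌋ + s) (j := ⌊b * n⌋ + s)
    (j' := ⌊b * n⌋ + s + 1) (k := ⌊c * n⌋ + s) (k' := ⌊c * n⌋ + s) (l := ⌊y * n⌋ + s)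
    (l' := ⌊y * n⌋ + s + 1) (m := 1) (R := R) le_rfl (by omega) le_rfl (by omega)
    (by have := floor_mul_le_floor_mul hab n; omega)
    (by have := floor_mul_le_floor_mul hcy n; omega) le_rfl hR1 (by simp) (by simp) (by simp)
    (by simp) hRgap
  -- (B) the upper corner against the translated marks
  have hB := move_le hesc (i := ⌊(a + t) * n⌋) (i' := ⌊a * n⌋ + s) (j := ⌊(b + t) * n⌋)
    (j' := ⌊b * n⌋ + s + 1) (k := ⌊(c + t) * n⌋) (k' := ⌊c * n⌋ + s) (l := ⌊(y + t) * n⌋)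
    (l' := ⌊y * n⌋ + s + 1) (m := 1) (R := R) (floor_add_floor_le_floor_add_mul a t n)
    (floor_add_mul_le b t n) (floor_add_floor_le_floor_add_mul c t n) (floor_add_mul_le y t n)
    (floor_mul_le_floor_mul (by linarith) n) (floor_mul_le_floor_mul (by linarith) n) le_rfl hR1
    (by have := floor_add_mul_le a t n; push_cast; omega)
    (by have := floor_add_floor_le_floor_add_mul b t n; push_cast; omega)
    (by have := floor_add_mul_le c t n; push_cast; omega)
    (by have := floor_add_floor_le_floor_add_mul y t n; push_cast; omega) hRgap
  have hshift := crossing_shift s ⌊a * n⌋ ⌊b * n⌋ ⌊c * n⌋ ⌊y * n⌋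
  rw [arcA_eq_rowIcc, arcA_eq_rowIcc, ← hshift, abs_le]
  push_cast at hA hB ⊢
  constructor <;> nlinarith [hA.1, hA.2, hB.1, hB.2]

/-- **Asymptotic translation invariance of `P_n`**: `P_n(a+t,b+t,c+t,y+t) − P_n(a,b,c,y) → 0`.
[folklore] -/
theorem tendsto_translate_sub (hα : 0 < α) {a b c y : ℝ} (hab : a ≤ b) (hbc : b < c) (hcy : c ≤ y)
    (t : ℝ) :
    Tendsto (fun n : ℕ ↦
      μ.real (openCrossing halfPlane (arcA (a + t) (b + t) n) (rowIcc ⌊(c + t) * n⌋ ⌊(y + t) * n⌋)) -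
        μ.real (openCrossing halfPlane (arcA a b n) (rowIcc ⌊c * n⌋ ⌊y * n⌋))) atTop (𝓝 0) := by
  have hg0 : 0 < c - b := by linarith
  refine squeeze_zero_norm' ?_ (tendsto_translate_error C hα hg0)
  filter_upwards [(tendsto_natCast_atTop_atTop.const_mul_atTop hg0).eventually_ge_atTop 8] with n hn
  rw [Real.norm_eq_abs]
  exact abs_translate_sub_le hesc hab hbc hcy t hn

end Moves

end Subseq

/-- **Registered extra stub of line `Sketch` (lead c2-0): equicontinuity of `P_n` in the marks.**
For admissible escape constants `C ≥ 0`, `α > 0`: if the arcs `[a,b]`, `[c,y]` grow to `[a',b']`,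
`[c',y']` with every mark moving by `≤ δ` and `10δ ≤ c' − b'`, then eventually in `n`,
`P_n(a',b',c',y') ≤ P_n(a,b,c,y) + 4C(8δ/(c'−b'))^α`. [folklore] -/
theorem stub_equicontinuity :
    ∀ (C α : ℝ), 0 ≤ C → 0 < α → (∀ p : unitInterval, (p : ℝ) ≤ 1 / 2 → ∀ r R : ℕ, 1 ≤ r → r ≤ R →
      (bondPercolation (zdGraph 2) p).real
        {ω | ∃ x ∈ box 2 r, ∃ y ∉ box 2 R, ω ∈ openConnIn Set.univ x y} ≤ C * ((r : ℝ) / R) ^ α) →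
    ∀ (a a' b b' c c' y y' δ : ℝ), a' ≤ a → b ≤ b' → c' ≤ c → y ≤ y' → a ≤ b → c ≤ y → 0 < δ →
      a - a' ≤ δ → b' - b ≤ δ → c - c' ≤ δ → y' - y ≤ δ → 10 * δ ≤ c' - b' →
      ∀ᶠ n : ℕ in atTop,
        μ.real (openCrossing halfPlane (arcA a' b' n) (rowIcc ⌊c' * n⌋ ⌊y' * n⌋)) ≤
          μ.real (openCrossing halfPlane (arcA a b n) (rowIcc ⌊c * n⌋ ⌊y * n⌋)) +
            4 * (C * (8 * δ / (c' - b')) ^ α) :=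
  fun _ _ hC hα hesc _ _ _ _ _ _ _ _ _ ha hb hc hy hab hcy hδ hda hdb hdc hdy hgap ↦
    Subseq.eventually_move_le hC hα hesc ha hb hc hy hab hcy hδ hda hdb hdc hdy hgap

/-- **Registered extra stub of line `Sketch` (lead c2-0): asymptotic translation invariance of `P_n`.**
`P_n(a+t,b+t,c+t,y+t) − P_n(a,b,c,y) → 0` for `a ≤ b < c ≤ y` and every real `t`. [folklore] -/
theorem stub_translationInvariance :
    ∀ (a b c y t : ℝ), a ≤ b → b < c → c ≤ y →
      Tendsto (fun n : ℕ ↦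
        μ.real (openCrossing halfPlane (arcA (a + t) (b + t) n) (rowIcc ⌊(c + t) * n⌋ ⌊(y + t) * n⌋)) -
          μ.real (openCrossing halfPlane (arcA a b n) (rowIcc ⌊c * n⌋ ⌊y * n⌋))) atTop (𝓝 0) := by
  obtain ⟨C, α, -, hα, hesc⟩ := exists_real_boxToFar_le_rpow_of_le_half
  exact fun a b c y t hab hbc hcy ↦ Subseq.tendsto_translate_sub hesc hα hab hbc hcy t

end Summit.CriticalPhenomena.CardyFormulaZ2.Cruxes.HalfPlaneMarkDensityLaw.SketchLine

end
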